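import Summits.Parity.GeneralizedHardyLittlewood.Theorems.PrimeLevelFamEdgeMomentsBeyondDiagonalDiagDecorPrimePowPeel
import HarnessLib

/-!
# Route `PrimeLevelFamEdge`, crux K_A `MomentsBeyondDiagonal` (stmt-Parity-20007), line «petersson_layers» v4, stub `stub_diag`:
# **the double prime peel of a MIXED product decoration `P_m·P_{m′}`:
# `Σ_k a_n(k)G(k)P_m(k)P_{m′}(k) = Σ_p log^{m+m′}p·a_n(p)·Σ_{k′}a_{np}(k′)G(pk′) + Σ_p log^m p·a_n(p)·Σ_{k′}a_{np}(k′)G(pk′)P_{m′}(k′)`**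

Companion of `…DiagDecorPrimePowPeel.sum_copTauW_mul_primeSq_sq_eq` (the case `m = m′`) for the mixed decorations of the higher
central divisor-log moments (`M₆ = τ(15P₂³ − 30P₂P₄ + 16P₆)`, `…DiagDecorWeightRungThree`: the `P₂P₄` family), peeling the prime
of `P_m` and splitting `P_{m′}(pk′) = log^{m′}p + P_{m′}(k′)` on the support of `a_{np}(k′)`:

* `sum_copTauW_mul_primePow_mul_primePow_eq` — the displayed identity (any `n, N`, weight `G`, powers `m, m′`); the first sum is
  the `P_{m+m′}`-peel (`…DiagDecorPrime.sum_copTauW_mul_mul_sum_primeFactors_eq` backwards), the second the cross term whose inner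
  sums are `P_{m′}`-decorated coprime sums at modulus `np` (`…DiagDecorPrimePowTwo` for every `m′`).

Def-free; theorems only. Helper `--supports stmt-Parity-20007`; closes nothing; K_A, K_B and the Parity summit are NOT proved;
nothing about Landau–Siegel zeros.

## References
* E. Kowalski, P. Michel, J. VanderKam, J. reine angew. Math. 526 (2000), (23)–(28) pp. 13–15.
  [cite: KowalskiMichelVanderKam2000, (23)–(28) — derivation (prime decorations → prime sums)]
-/

noncomputable section

open scoped Real
open Finset ArithmeticFunction

namespace Summit.Parity.GeneralizedHardyLittlewood.Theorems.MomentsBeyondDiagonal.DiagLines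

open Literature.NumberTheory.LFunctions.KMV2000
open Summit.Parity.GeneralizedHardyLittlewood.Theorems.BeyondDiagonalBeatsQuarter.KernelFormXSq (copTauW)

/-- **The double prime peel of a mixed product decoration** (see the module docstring).
[cite: KowalskiMichelVanderKam2000, (23)–(28) — derivation (prime decorations → prime sums)] -/
theorem sum_copTauW_mul_primePow_mul_primePow_eq (n N m m' : ℕ) (G : ℕ → ℝ) :
    ∑ k ∈ Icc 1 N, copTauW n k * G k *
        ((∑ q ∈ k.primeFactors, Real.log q ^ m) * ∑ q ∈ k.primeFactors, Real.log q ^ m') =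
      ∑ p ∈ (Icc 1 N).filter Nat.Prime, Real.log p ^ (m + m') * copTauW n p *
          ∑ k ∈ Icc 1 (N / p), copTauW (n * p) k * G (p * k) +
        ∑ p ∈ (Icc 1 N).filter Nat.Prime, Real.log p ^ m * copTauW n p *
          ∑ k ∈ Icc 1 (N / p), copTauW (n * p) k * (G (p * k) * ∑ q ∈ k.primeFactors, Real.log q ^ m') := by
  have h := sum_copTauW_mul_mul_sum_primeFactors_eq n N (fun k ↦ G k * ∑ q ∈ k.primeFactors, Real.log q ^ m')
    (fun p ↦ Real.log p ^ m)
  have hl : ∑ k ∈ Icc 1 N, copTauW n k * G k *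
      ((∑ q ∈ k.primeFactors, Real.log q ^ m) * ∑ q ∈ k.primeFactors, Real.log q ^ m') =
      ∑ k ∈ Icc 1 N, copTauW n k * (G k * ∑ q ∈ k.primeFactors, Real.log q ^ m') *
        ∑ p ∈ k.primeFactors, Real.log p ^ m :=
    Finset.sum_congr rfl fun k _ ↦ by ring
  rw [hl, h, ← Finset.sum_add_distrib]
  refine Finset.sum_congr rfl fun p hp ↦ ?_
  have hp' : p.Prime := (Finset.mem_filter.1 hp).2
  rw [mul_assoc (Real.log p ^ (m + m')), mul_assoc (Real.log p ^ m) (copTauW n p), mul_assoc (Real.log p ^ m) (copTauW n p),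
    Finset.mul_sum, Finset.mul_sum, Finset.mul_sum, Finset.mul_sum, Finset.mul_sum, Finset.mul_sum,
    ← Finset.sum_add_distrib]
  refine Finset.sum_congr rfl fun k _ ↦ ?_
  have hsplit := copTauW_mul_primePowSum_prime_mul hp' n k m'
  calc Real.log p ^ m * (copTauW n p * (copTauW (n * p) k * (G (p * k) * ∑ q ∈ (p * k).primeFactors, Real.log q ^ m')))
      = Real.log p ^ m * (copTauW n p * G (p * k)) *
          (copTauW (n * p) k * ∑ q ∈ (p * k).primeFactors, Real.log q ^ m') := by ring
    _ = Real.log p ^ m * (copTauW n p * G (p * k)) *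
          (copTauW (n * p) k * (Real.log p ^ m' + ∑ q ∈ k.primeFactors, Real.log q ^ m')) := by rw [hsplit]
    _ = Real.log p ^ (m + m') * (copTauW n p * (copTauW (n * p) k * G (p * k))) +
          Real.log p ^ m * (copTauW n p * (copTauW (n * p) k * (G (p * k) * ∑ q ∈ k.primeFactors, Real.log q ^ m'))) := by
        rw [pow_add]; ring

end Summit.Parity.GeneralizedHardyLittlewood.Theorems.MomentsBeyondDiagonal.DiagLines

end
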